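import Summits.QuantumFields.QCD.Theses.PauliWegnerSea
import Summits.QuantumFields.QCD.Theorems.PauliWegnerSeaFibreCofactorDominationStubCplusOfCrux

/-!
# Crux `FibreCofactorDomination` (K1 of `PauliWegnerSea`, stmt-QuantumFields-11510), negative side —
# the crux is false modulo an exact dark leaf / modulo a window-free ratio blow-up

Lead's negative-modulo file (line `Sketch-ideator3`, continuation lead c1).  Two hypotheses under which
the crux FAILS, stated as `Prop`s so that a later construction closes the item mechanically:

* `DarkLeaf` — an EXACT dark leaf of the two-star fibre: a bare mass `m₀ ∈ [-2, 2]`, a torus of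
  side `L ≥ 4`, a background `U`, sites `x ≠ y` and one refit `W₀` such that `det D_W(refit W') = 0`
  for EVERY refit `W'` of the links of `star(x) ∪ star(y)` while the `(x, y)` adjugate block of
  `D_W(refit W₀)` is non-zero.  Then the right-hand side of the crux vanishes on the whole fibre
  and its left-hand side does not: `FibreCofactorDomination_false_of_DarkLeaf`.
  (Abstract dark leaves — port Green data not known to be realised by an exterior — exist, see
  the crux folder `Cruxes/FibreCofactorDomination/`; realisability by a Wilson–Dirac exterior is the
  open point, plausible by parameter counting from `L ≈ 8`.)
* `RatioBlowup` — the window-free quantitative form: for some `m₀ ∈ [-2, 2]` and every constant `C`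
  there are `L ≥ 4`, `U`, `x ≠ y`, `W₀` with `C (1 + 12L⁴) ‖det D_W(refit W')‖ < Σ ‖adj_xy(refit W₀)‖`
  for all `W'`.  Since the in-window count never exceeds `12 L⁴ = Fintype.card (sites × colour × spin)`
  (`RandomRefit.countP_roots_charpoly_le_card`, p90796), this kills the crux for every window:
  `FibreCofactorDomination_false_of_RatioBlowup`; and `DarkLeaf → RatioBlowup`.

Neither hypothesis is constructed here (the item stays open); they are the targets of the crux's
disprover.  Elementary.
-/

noncomputable section

namespace Summit.QuantumFields.QCD.Theorems.FibreCofactorDominationNegative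

open scoped BigOperators Matrix
open MeasureTheory Filter Literature.MathematicalPhysics.QuantumFieldTheory
  Literature.MathematicalPhysics.QuantumLattice Literature.Probability.LatticeModels

/-- An exact DARK LEAF of the two-star fibre of the `r = 1` fundamental `SU(3)` Wilson–Dirac operator:
`m₀ ∈ [-2,2]`, `L ≥ 4`, a background `U`, sites `x ≠ y` and a refit `W₀` of the links of
`star(x) ∪ star(y)` such that the fermion determinant vanishes for EVERY refit of those links while the
`(x,y)` adjugate block at `W₀` does not.  (The object a refutation of `FibreCofactorDomination` must
construct; HYPOTHESIS of a negative lemma, deliberately NOT tagged as a literature fact; not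
constructed in the tree.) -/
def DarkLeaf : Prop :=
  ∃ m₀ : ℝ, -2 ≤ m₀ ∧ m₀ ≤ 2 ∧ ∃ (L : ℕ) (_ : NeZero L), 4 ≤ L ∧
    ∃ (U : GaugeConfig 4 L (Matrix.specialUnitaryGroup (Fin 3) ℂ)) (x y : TorusSite 4 L), x ≠ y ∧
    ∃ W₀ : GaugeConfig 4 L (Matrix.specialUnitaryGroup (Fin 3) ℂ),
      (∀ W' : GaugeConfig 4 L (Matrix.specialUnitaryGroup (Fin 3) ℂ),
        (wilsonDirac (fundamentalRep (Fin 3))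
          (fun e => if e.1 = x ∨ Site.shift e.1 e.2 = x ∨ e.1 = y ∨ Site.shift e.1 e.2 = y
            then W' e else U e) m₀ 1).det = 0) ∧
      0 < ∑ a : Fin 3, ∑ i : Fin 4, ∑ b : Fin 3, ∑ j : Fin 4,
        ‖(wilsonDirac (fundamentalRep (Fin 3))
          (fun e => if e.1 = x ∨ Site.shift e.1 e.2 = x ∨ e.1 = y ∨ Site.shift e.1 e.2 = y
            then W₀ e else U e) m₀ 1).adjugate (x, a, i) (y, b, j)‖

/-- Window-free RATIO BLOW-UP along the volumes: for some bare mass `m₀ ∈ [-2,2]` and every constant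
`C` there are a torus `L ≥ 4`, a background `U`, sites `x ≠ y` and a refit `W₀` such that
`C · (1 + 12L⁴) · ‖det D_W(refit W')‖ < Σ ‖adj_xy(D_W(refit W₀))‖` for every refit `W'`
(`12 L⁴ = Fintype.card (TorusSite 4 L × Fin 3 × Fin 4)`, the largest possible in-window count).
(The quantitative object a refutation must exhibit; HYPOTHESIS of a negative lemma, deliberately NOT
tagged as a literature fact; not constructed in the tree.) -/
def RatioBlowup : Prop :=
  ∃ m₀ : ℝ, -2 ≤ m₀ ∧ m₀ ≤ 2 ∧ ∀ C : ℝ, ∃ (L : ℕ) (_ : NeZero L), 4 ≤ L ∧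
    ∃ (U : GaugeConfig 4 L (Matrix.specialUnitaryGroup (Fin 3) ℂ)) (x y : TorusSite 4 L), x ≠ y ∧
    ∃ W₀ : GaugeConfig 4 L (Matrix.specialUnitaryGroup (Fin 3) ℂ),
      ∀ W' : GaugeConfig 4 L (Matrix.specialUnitaryGroup (Fin 3) ℂ),
        C * (1 + (Fintype.card (TorusSite 4 L × Fin 3 × Fin 4) : ℝ)) *
          ‖(wilsonDirac (fundamentalRep (Fin 3))
            (fun e => if e.1 = x ∨ Site.shift e.1 e.2 = x ∨ e.1 = y ∨ Site.shift e.1 e.2 = y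
              then W' e else U e) m₀ 1).det‖ <
        ∑ a : Fin 3, ∑ i : Fin 4, ∑ b : Fin 3, ∑ j : Fin 4,
          ‖(wilsonDirac (fundamentalRep (Fin 3))
            (fun e => if e.1 = x ∨ Site.shift e.1 e.2 = x ∨ e.1 = y ∨ Site.shift e.1 e.2 = y
              then W₀ e else U e) m₀ 1).adjugate (x, a, i) (y, b, j)‖

/-- An exact dark leaf gives the ratio blow-up (the right-hand side is `0 <` a positive sum). -/
theorem ratioBlowup_of_darkLeaf (h : DarkLeaf) : RatioBlowup := by
  obtain ⟨m₀, hm₁, hm₂, L, hL0, hL, U, x, y, hxy, W₀, hdet, hadj⟩ := h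
  refine ⟨m₀, hm₁, hm₂, fun C => ⟨L, hL0, hL, U, x, y, hxy, W₀, fun W' => ?_⟩⟩
  rw [hdet W', norm_zero, mul_zero]
  exact hadj

/-- **The crux is false modulo a ratio blow-up.**  If `RatioBlowup` holds then
`PauliWegnerSea.FibreCofactorDomination` fails: whatever window `θ₀` and constant `C₀` the crux
offers at the bad mass, the in-window count is at most `12 L⁴`, so the crux's bound is at most
`C₀ (1 + 12L⁴) ‖det‖`, which the blow-up beats at some volume. -/
theorem FibreCofactorDomination_false_of_RatioBlowup (h : RatioBlowup) :
    ¬ Summit.QuantumFields.QCD.Theses.PauliWegnerSea.FibreCofactorDomination := by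
  intro hK
  obtain ⟨m₀, hm₁, hm₂, hbad⟩ := h
  obtain ⟨θ₀, C₀, _hθ, hC, hmain⟩ := hK m₀ hm₁ hm₂
  obtain ⟨L, hL0, hL, U, x, y, hxy, W₀, hW₀⟩ := hbad C₀
  have h1 := hmain L hL U x y hxy
  dsimp only at h1
  obtain ⟨W', hW'⟩ := h1 W₀
  have hnw := Summit.QuantumFields.QCD.Theorems.RandomRefit.countP_roots_charpoly_le_card
    (L := L) θ₀ m₀ U
  have h2 := hW₀ W'
  have h3 : C₀ * (1 + (Multiset.countP (fun z : ℂ => |z.re| < θ₀)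
      (spinorLift gammaFive * wilsonDirac (fundamentalRep (Fin 3)) U m₀ 1).charpoly.roots : ℝ)) *
      ‖(wilsonDirac (fundamentalRep (Fin 3))
        (fun e => if e.1 = x ∨ Site.shift e.1 e.2 = x ∨ e.1 = y ∨ Site.shift e.1 e.2 = y
          then W' e else U e) m₀ 1).det‖ ≤
      C₀ * (1 + (Fintype.card (TorusSite 4 L × Fin 3 × Fin 4) : ℝ)) *
      ‖(wilsonDirac (fundamentalRep (Fin 3))
        (fun e => if e.1 = x ∨ Site.shift e.1 e.2 = x ∨ e.1 = y ∨ Site.shift e.1 e.2 = y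
          then W' e else U e) m₀ 1).det‖ := by
    gcongr
  linarith

/-- **The crux is false modulo an exact dark leaf.** -/
theorem FibreCofactorDomination_false_of_DarkLeaf (h : DarkLeaf) :
    ¬ Summit.QuantumFields.QCD.Theses.PauliWegnerSea.FibreCofactorDomination :=
  FibreCofactorDomination_false_of_RatioBlowup (ratioBlowup_of_darkLeaf h)

end Summit.QuantumFields.QCD.Theorems.FibreCofactorDominationNegative
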